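import Literature.MathematicalPhysics.QuantumFieldTheory.Balaban1983to89.B8Eq1101CubeMemberCutoffs

/-!
# `Balaban1983to89.B8Eq1101CubeMemberParametrixIdentity` — THE TWO-REGION PARAMETRIX for [Balaban1985RegularSpaces] (1.101) at `U₀ = 1` on the cube member
# `{□_j}` of (1.131): the identity `T·P u = u + K₁u` row by row on `□₀`, the inputs∕outputs of the two regions in the `(−2)`-weighted sup norm, the bound on
# `P u`, the SMALLNESS of the commutator `K₁` (`≤ 10(d+1)L²(C′_A + C_B)∕s`), and the gradient of `P u` at deep bonds
# ([Balaban1984PropagatorsII] (2.49)–(2.58) p. 231–233 — the random-walk ∕ parametrix expansion, specialised to TWO regions)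

statement-level skeleton of published theorems with citation tags; proofs where landed; nothing here is a claim about the
Yang–Mills mass gap

`[Balaban1985RegularSpaces]` ("B8", CMP **99** (1985) 75–102) (1.101) p. 93, (1.91) p. 91, p. 98, (1.131) p. 99; `[Balaban1984PropagatorsII]` ("B6", CMP **96**
(1984) 223–250) (2.47)–(2.58) p. 231–233 («G = Σ_□ h̃_□G(□)h_□ + … the norms of the operators … are small for M sufficiently large»), (2.13)–(2.14) p. 225,
(2.67) p. 234; `[Balaban1985BackgroundPropagators]` ("[4]") Theorem 3.1 p. 397.  PDF held: `paper:balaban1985-cmp99-regular-spaces-gauge-fixing`.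

CITATION HEADER (lean-in-tree rule).  Cell `pub-ymgap` (YM Track A, HUMAN RULING D-0062), DAG node N05 = [B8], seat `pub-ymgap-dag-n05-c` (g9; (R1′)-v2 HYBRID
route for REAL-1 = (1.101) of `B8Prop6CubeMemberFlatScalar.prop6_cubeMember_flat_of_real`, file F4b).  Inputs BY NAME: F1 `B8CubeMemberBoxDomains` (the member
`cubeDomains`, r05's hypothesis-free (1.101) read at it), F2 `B8CubeMemberBoxRows.row_eq_mlOp_row` (the rows of `K` at interior sites of `□₁` are the rows of
`η⁻²·mlOp`), F3 `B8Eq191FlatDirichletWall.wall_rowBound` (the wall piece), F4a `B8Eq1101CubeMemberCutoffs` (cutoffs `h_A, h̃_A, h_B, h̃_B`, the wall `W`),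
p21's `B6MultiLevelBoxOperator.mlOp_mul_gml`, n05-e's `B8Eq191FlatDirichletForm.isUnit_flatMatrix`.  THE PARAMETRIX: for a lattice function `u`,
`P u = h̃_A·η²·(G′·(h_Au)(· − t))(· + t) + h̃_B·((K|_W)⁻¹(h_Bu))`, `G′ = gml` p21's inverse on the host Neumann box, `K|_W` the principal submatrix on the wall;
the objects are characterised by their defining equations (hypotheses `huA`, `hgAx`, `huB`, `hgBx`, `hgBx0`), so that the successor file can instantiate them.

WHAT THIS FILE PROVES (kernel-checked; theorems only; `L = ℓ + 1`, dimension `d + 1`, cube datum with F1's side conditions `M_hL ∣ ρ`, `M_hL ∣ M`,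
`R·M_hL ≤ ρ`; weights `w_j ≥ 0` with `w_j·L^{−2(d+1)j} = η⁻²·levC d ℓ a_j` for `1 ≤ j ≤ n`, p21 weights `a_j > 0`; ramp length `s ≥ 1`, wall parameter `m_W`).
* §1 ★★★ `parametrix_identity` — for EVERY `u` and every `x ∈ □₀`:
  `Σ_{z∈□₀}K(x,z)(h̃_A(z)η²gAx(z) + h̃_B(z)gBx(z)) = u(x) + Σ_{z∈□₀}K(x,z)((h̃_A(z) − h̃_A(x))η²gAx(z) + (h̃_B(z) − h̃_B(x))gBx(z))` (`m_W ≥ 4s`).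
  Region A: where `h̃_A(x) ≠ 0` the `K`-row is the `η⁻²mlOp`-row (F2) and `mlOp·gml = 1`; region B: where `h̃_B(x) ≠ 0`, `x ∈ W` and the row of `K·(K|_W)⁻¹` is
  `δ_x` (the off-wall part of the row meets `gBx = 0`); then `h̃h = h` and `h_A + h_B = 1`.
* §2 `mem_cube_one_of_cutA_ne_zero`, ★ `regionA_bounds` — the consumer's weighted bound `(Lʲη)²|u| ≤ N` on `□_j` makes `uA` satisfy r05's input hypothesis
  with `S = Nη⁻²` (the level of the host box IS the tower level, F1), hence `η²|G′uA| ≤ C′N` and `η²|∂_μG′uA| ≤ C′N(L^{lev})⁻¹` given region A's (1.101) package.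
* §3 ★ `regionB_bound` — `|(K|_W)⁻¹(h_Bu)| ≤ (2L²∕a₀)·c₀((2(d+1)L)⁻¹)^{d+1}·N` (F3 at `θ = ½`, `δ′ = 1∕(2(d+1))`, the wall hypotheses from F4a; `2 ≤ a₀ ≤ 8`).
* §4 `parametrix_sup` (`|P u| ≤ A + B`), `abs_row_le` (a row of `|K|` against a nonnegative function, any finite `S`), `card_filter_block_le`, ★★★
  `commutator_bound` — `(Lʲη)²|K₁u(x)| ≤ 10(d+1)L²(A + B)∕s` on `□_j` (`A ≥ η²|gAx|`, `B ≥ |gBx|`, `4s ≤ ρL`): zero at tower levels `≥ 2` (plateaus of the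
  cutoffs deeper than `4s`), and at levels `≤ 1` the `2(d+1)` neighbour entries `η⁻²` meet differences `≤ 1∕s`, the `≤ L^{d+1}` block entries
  `η⁻²a₁L^{−2}L^{−(d+1)}` meet differences `≤ (d+1)(L−1)∕s`.
* §5 `parametrix_grad_deep` — at a bond both of whose ends have depth `≥ 4s` into `□₁`: `(Pu)(y+e_μ) − (Pu)(y) = η²·(dMat_μ·G′uA)(y + t)`.

HONEST SCOPE ∕ NOT CLAIMED.  This is the algebra and the size bookkeeping of the gluing; the analytic inputs are F1 (region A, p21∕r05) and F3 (wall); the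
consumer-shaped (1.101) — the a-priori inversion of `1 + K₁` and the gradient member with `SideTouches` weights — is the successor file
`B8Eq1101CubeMemberReal`.  The constants (`10(d+1)L²`, `c₀`) are far from print's; only their independence of `η, k, M, R₁M₁` matters.  Count-neutral; N05
NOT discharged; one finite `T⁴` programme at fixed `ε`, Bałaban as printed; nothing continuum ∕ ℝ⁴ ∕ OS ∕ mass-gap ∕ Clay.  No `sorry`, no `def`, no `instance`,
no `notation`.  Unit `pub-ymgap-dag-n05-c` (g9), 2026-08-27.

RELATED IN THE TREE, NOT DUPLICATED: `B8CubeMemberBoxDomains.*`, `B8CubeMemberBoxRows.*`, `B8Eq191FlatDirichletWall.*`, `B8Eq1101CubeMemberCutoffs.*` (F1–F4a, USED BY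
NAME); `B6RandomWalk.*` ∕ `B6Expansion282.*` ∕ `B6Prop22MultiLevelBox.*` (p21's full multi-cube expansion on the Neumann box — the machinery INSIDE region A,
not re-run here); `B8Eq191FlatDirichletCoercive.block_eq_image` (USED for the block count).
-/
noncomputable section

namespace Literature.MathematicalPhysics.QuantumFieldTheory.Balaban1983to89.B8Eq1101CubeMemberParametrixIdentity

open scoped Matrix
open B6MultiLevelBoxOperator (Domains N0 mlOp gml levC)
open B4Reflection242 (boxDom mem_boxDom blk)
open B7Prop1Explicit (e)
open B8Eq131Cubes (l1dist cube)
open B8Eq131CubesAdmissible (cubeFam cubeFam_false_of_le)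
open B8CubeMemberZd (cubeLamS)
open B8Eq191FlatDirichletDepth (depth)
open B8Eq191FlatDirichletForm (isUnit_flatMatrix)
open B8CubeMemberBoxDomains (shift boxP lev cubeDomains mem_boxDom_of_mem_cube add_shift_sub_shift lev_le one_le_lev)
open B8CubeMemberBoxRows (row_eq_mlOp_row)
open B8Eq1101CubeMemberCutoffs (cutA cutAt cutB cutBt wall cutAt_mul_cutA cutBt_mul_cutB cutA_add_cutB depth_of_cutAt_ne_zero cutBt_facts
  mem_wall_of_depth_le wall_subset)
open Literature.MathematicalPhysics.QuantumLattice (blockMap)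

variable {d : ℕ}

/-! ## §1 The identity `T·P u = u + K₁u` on `□₀` -/

open Classical in
/-- **THE PARAMETRIX IDENTITY, ROW BY ROW.**  Data: the cube member at truncation `n` with the big-block side conditions of F1, weights `w` (nonnegative,
`w_j·L^{−2(d+1)j} = η⁻²levC_j` for `1 ≤ j ≤ n`, p21 weights `a_j > 0`), the consumer's explicit matrix `K` on `S = □₀`, ramp length `s ≥ 1`, wall
parameter `m_W ≥ 4s`.  Objects (characterised by their defining equations): `uA = (h_A u)(· − t)` on the host box `X`, `gA = G′·uA` (`G′ = gml`, p21's
inverse at the member), its pull-back `gAx = gA(· + t)` (zero off `X − t`); `uB = h_B u` on the wall `W`, `gB = (K|_W)⁻¹uB`, its extension `gBx` by zero.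
Then at every `x ∈ □₀`:
`Σ_{z∈□₀} K(x,z)·(h̃_A(z)·η²gAx(z) + h̃_B(z)·gBx(z)) = u(x) + Σ_{z∈□₀} K(x,z)·((h̃_A(z) − h̃_A(x))·η²gAx(z) + (h̃_B(z) − h̃_B(x))·gBx(z))`
— i.e. `T·P u = u + K₁u` with `P u = h̃_A·η²gAx + h̃_B·gBx` and the commutator remainder `K₁`.  Region A: where `h̃_A(x) ≠ 0` the row of `K` is the row of
`η⁻²·mlOp` (F2 `row_eq_mlOp_row`) and `mlOp·gml = 1`; region B: where `h̃_B(x) ≠ 0`, `x ∈ W` and `Σ_{z∈W}K(x,z)(K|_W)⁻¹(z,·) = δ_x`; then `h̃h = h` and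
`h_A + h_B = 1`. [cite: Balaban1984PropagatorsII, (2.49)–(2.50) p.231–232; Balaban1985RegularSpaces, (1.101) p.93, p.98] -/
theorem parametrix_identity {ℓ Mh : ℕ} (hℓ : 1 ≤ ℓ) (hMh : 1 ≤ Mh) (a : Fin (d + 1) → ℤ) {M ρ k n R : ℕ} (hn : 1 ≤ n) (hnk : n ≤ k)
    (hρd : Mh * (ℓ + 1) ∣ ρ) (hMd : Mh * (ℓ + 1) ∣ M) (hρ0 : 0 < ρ) (hR : R * (Mh * (ℓ + 1)) ≤ ρ)
    {η : ℝ} (hη : η ≠ 0) (w aw : ℕ → ℝ) (hw0 : ∀ j, 0 ≤ w j) (haw : ∀ j, 0 < aw j)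
    (hw : ∀ j, 1 ≤ j → j ≤ n → w j * (((((ℓ + 1 : ℕ) : ℝ) ^ (d + 1))⁻¹) ^ j) ^ 2 = (η ^ 2)⁻¹ * levC d ℓ aw j)
    (K : (Fin (d + 1) → ℤ) → (Fin (d + 1) → ℤ) → ℝ)
    (hK : ∀ x z, K x z = ((η ^ 2)⁻¹ * ∑ μ : Fin (d + 1), ((2 : ℝ) * (if z = x then (1 : ℝ) else 0) - (if z = x + e μ then (1 : ℝ) else 0)
        - (if z = x - e μ then (1 : ℝ) else 0))) +
        (∑ j ∈ Finset.range (n + 1), (if blockMap ((ℓ + 1) ^ j) x ∈ cubeLamS (ℓ + 1) a M ρ k n j ∧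
            blockMap ((ℓ + 1) ^ j) z = blockMap ((ℓ + 1) ^ j) x then
          w j * (((((ℓ + 1 : ℕ) : ℝ) ^ (d + 1))⁻¹) ^ j) ^ 2 else 0)))
    (S : Finset (Fin (d + 1) → ℤ)) (hS : ∀ z, z ∈ S ↔ z ∈ cubeFam false (ℓ + 1) a M ρ k 0)
    {s : ℕ} (hs : 1 ≤ s) {mW : ℕ} (hmW : 4 * s ≤ mW)
    (u : (Fin (d + 1) → ℤ) → ℝ)
    (uA : ↥(boxDom (N0 ℓ Mh n (boxP ℓ M ρ k n))) → ℝ)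
    (huA : ∀ y, uA y = cutA (Nat.succ_pos d) (ℓ + 1) a M ρ k s (y.1 - shift ℓ Mh a ρ k n) * u (y.1 - shift ℓ Mh a ρ k n))
    (gAx : (Fin (d + 1) → ℤ) → ℝ)
    (hgAx : ∀ y : ↥(boxDom (N0 ℓ Mh n (boxP ℓ M ρ k n))),
      gAx (y.1 - shift ℓ Mh a ρ k n) = (gml (N0 ℓ Mh n (boxP ℓ M ρ k n)) ℓ n (lev ℓ Mh a M ρ k n) aw *ᵥ uA) y)
    (uB : ↥(wall (Nat.succ_pos d) (ℓ + 1) a M ρ k S mW) → ℝ) (huB : ∀ y, uB y = cutB (Nat.succ_pos d) (ℓ + 1) a M ρ k s y.1 * u y.1)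
    (gBx : (Fin (d + 1) → ℤ) → ℝ)
    (hgBx : ∀ y : ↥(wall (Nat.succ_pos d) (ℓ + 1) a M ρ k S mW),
      gBx y.1 = ((Matrix.of fun x z : ↥(wall (Nat.succ_pos d) (ℓ + 1) a M ρ k S mW) => K x.1 z.1)⁻¹ *ᵥ uB) y)
    (hgBx0 : ∀ z, z ∉ wall (Nat.succ_pos d) (ℓ + 1) a M ρ k S mW → gBx z = 0)
    {x : Fin (d + 1) → ℤ} (hx : x ∈ S) :
    ∑ z ∈ S, K x z * (cutAt (Nat.succ_pos d) (ℓ + 1) a M ρ k s z * (η ^ 2 * gAx z) + cutBt (Nat.succ_pos d) (ℓ + 1) a M ρ k s z * gBx z)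
      = u x + ∑ z ∈ S, K x z * ((cutAt (Nat.succ_pos d) (ℓ + 1) a M ρ k s z - cutAt (Nat.succ_pos d) (ℓ + 1) a M ρ k s x) * (η ^ 2 * gAx z)
          + (cutBt (Nat.succ_pos d) (ℓ + 1) a M ρ k s z - cutBt (Nat.succ_pos d) (ℓ + 1) a M ρ k s x) * gBx z) := by
  have hL : 1 ≤ ℓ + 1 := Nat.succ_pos ℓ
  have hk : 1 ≤ k := hn.trans hnk
  have hρL : ℓ + 1 ≤ ρ := le_trans (Nat.le_mul_of_pos_left _ hMh) (Nat.le_of_dvd hρ0 hρd)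
  have hx0 : x ∈ cube (ℓ + 1) a M ρ k 0 := by rw [← cubeFam_false_of_le (ℓ + 1) a M ρ (Nat.zero_le k)]; exact (hS x).mp hx
  -- REGION A: `h̃_A(x)·Σ_z K(x,z)·η²gAx(z) = h_A(x)u(x)`
  have hA0 : cutAt (Nat.succ_pos d) (ℓ + 1) a M ρ k s x * ∑ z ∈ S, K x z * (η ^ 2 * gAx z)
      = cutA (Nat.succ_pos d) (ℓ + 1) a M ρ k s x * u x := by
    by_cases h0 : cutAt (Nat.succ_pos d) (ℓ + 1) a M ρ k s x = 0
    · have : cutA (Nat.succ_pos d) (ℓ + 1) a M ρ k s x = 0 := by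
        rw [← cutAt_mul_cutA (Nat.succ_pos d) (ℓ + 1) a M ρ k hs x, h0, zero_mul]
      rw [h0, this, zero_mul, zero_mul]
    · obtain ⟨-, hx1, hxe⟩ := depth_of_cutAt_ne_zero (Nat.succ_pos d) (ℓ + 1) a M ρ k hs hk h0
      have hrow := row_eq_mlOp_row hℓ hMh a hn hnk hρd hMd hρ0 hR w aw hw K hK S hS hx1 hxe (fun z => η ^ 2 * gAx z)
      have hsum : ∑ y : ↥(boxDom (N0 ℓ Mh n (boxP ℓ M ρ k n))),
          mlOp (N0 ℓ Mh n (boxP ℓ M ρ k n)) ℓ n (lev ℓ Mh a M ρ k n) aw ⟨x + shift ℓ Mh a ρ k n, mem_boxDom_of_mem_cube hℓ hMh a hn hnk hx1⟩ y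
            * (η ^ 2 * gAx (y.1 - shift ℓ Mh a ρ k n))
          = η ^ 2 * (mlOp (N0 ℓ Mh n (boxP ℓ M ρ k n)) ℓ n (lev ℓ Mh a M ρ k n) aw *ᵥ
              (gml (N0 ℓ Mh n (boxP ℓ M ρ k n)) ℓ n (lev ℓ Mh a M ρ k n) aw *ᵥ uA))
              ⟨x + shift ℓ Mh a ρ k n, mem_boxDom_of_mem_cube hℓ hMh a hn hnk hx1⟩ := by
        rw [Matrix.mulVec, dotProduct, Finset.mul_sum]
        refine Finset.sum_congr rfl fun y _ => ?_
        rw [hgAx y]; ring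
      have hN1 : ∀ i : Fin (d + 1), 1 ≤ N0 ℓ Mh n (boxP (d := d) ℓ M ρ k n) i := by
        intro i
        simp only [N0, boxP]
        exact Nat.mul_pos (pow_pos hL _) (Nat.mul_pos hL (Nat.mul_pos hMh (lt_of_lt_of_le hρ0 (Nat.le_add_right _ _))))
      have hinv : mlOp (N0 ℓ Mh n (boxP ℓ M ρ k n)) ℓ n (lev ℓ Mh a M ρ k n) aw *ᵥ
          (gml (N0 ℓ Mh n (boxP ℓ M ρ k n)) ℓ n (lev ℓ Mh a M ρ k n) aw *ᵥ uA) = uA := by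
        rw [Matrix.mulVec_mulVec, B6MultiLevelBoxOperator.mlOp_mul_gml hN1 (fun y => lev_le ℓ Mh a M ρ k hn y) haw, Matrix.one_mulVec]
      rw [hrow, hsum, hinv, huA]
      dsimp only
      have hη2 : η ^ 2 ≠ 0 := pow_ne_zero 2 hη
      rw [add_shift_sub_shift, show (η ^ 2)⁻¹ * (η ^ 2 * (cutA (Nat.succ_pos d) (ℓ + 1) a M ρ k s x * u x))
        = cutA (Nat.succ_pos d) (ℓ + 1) a M ρ k s x * u x by field_simp, ← mul_assoc,
        cutAt_mul_cutA (Nat.succ_pos d) (ℓ + 1) a M ρ k hs x]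
  -- REGION B: `h̃_B(x)·Σ_z K(x,z)·gBx(z) = h_B(x)u(x)`
  have hB0 : cutBt (Nat.succ_pos d) (ℓ + 1) a M ρ k s x * ∑ z ∈ S, K x z * gBx z
      = cutB (Nat.succ_pos d) (ℓ + 1) a M ρ k s x * u x := by
    by_cases h0 : cutBt (Nat.succ_pos d) (ℓ + 1) a M ρ k s x = 0
    · have : cutB (Nat.succ_pos d) (ℓ + 1) a M ρ k s x = 0 := by
        rw [← cutBt_mul_cutB (Nat.succ_pos d) (ℓ + 1) a M ρ k hs x, h0, zero_mul]
      rw [h0, this, zero_mul, zero_mul]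
    · obtain ⟨-, hδ⟩ := (cutBt_facts (Nat.succ_pos d) (ℓ + 1) a M ρ k hs x).1 h0
      have hxW : x ∈ wall (Nat.succ_pos d) (ℓ + 1) a M ρ k S mW := mem_wall_of_depth_le (Nat.succ_pos d) (ℓ + 1) a M ρ k S mW hx (by omega)
      have hsub : wall (Nat.succ_pos d) (ℓ + 1) a M ρ k S mW ⊆ S := wall_subset (Nat.succ_pos d) (ℓ + 1) a M ρ k S mW
      have h1 : ∑ z ∈ S, K x z * gBx z = ∑ z ∈ wall (Nat.succ_pos d) (ℓ + 1) a M ρ k S mW, K x z * gBx z := by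
        rw [← Finset.sum_subset hsub (fun z _ hz => by rw [hgBx0 z hz, mul_zero])]
      have h2 : ∑ z ∈ wall (Nat.succ_pos d) (ℓ + 1) a M ρ k S mW, K x z * gBx z
          = ((Matrix.of fun x z : ↥(wall (Nat.succ_pos d) (ℓ + 1) a M ρ k S mW) => K x.1 z.1) *ᵥ
              ((Matrix.of fun x z : ↥(wall (Nat.succ_pos d) (ℓ + 1) a M ρ k S mW) => K x.1 z.1)⁻¹ *ᵥ uB)) ⟨x, hxW⟩ := by
        rw [Matrix.mulVec, dotProduct, ← Finset.sum_coe_sort (wall (Nat.succ_pos d) (ℓ + 1) a M ρ k S mW)]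
        refine Finset.sum_congr rfl fun z _ => ?_
        rw [hgBx z, Matrix.of_apply]
      have hTunit : IsUnit (Matrix.of fun x z : ↥(wall (Nat.succ_pos d) (ℓ + 1) a M ρ k S mW) => K x.1 z.1) :=
        isUnit_flatMatrix (Nat.succ_pos d) hη (ℓ + 1) n (cubeLamS (ℓ + 1) a M ρ k n) w hw0 K hK _
      have hTT : (Matrix.of fun x z : ↥(wall (Nat.succ_pos d) (ℓ + 1) a M ρ k S mW) => K x.1 z.1)
          * (Matrix.of fun x z : ↥(wall (Nat.succ_pos d) (ℓ + 1) a M ρ k S mW) => K x.1 z.1)⁻¹ = 1 :=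
        Matrix.mul_nonsing_inv _ ((Matrix.isUnit_iff_isUnit_det _).mp hTunit)
      rw [h1, h2, Matrix.mulVec_mulVec, hTT, Matrix.one_mulVec, huB]
      dsimp only
      rw [← mul_assoc, cutBt_mul_cutB (Nat.succ_pos d) (ℓ + 1) a M ρ k hs x]
  -- assemble
  have hsplit : ∀ z ∈ S, K x z * (cutAt (Nat.succ_pos d) (ℓ + 1) a M ρ k s z * (η ^ 2 * gAx z) + cutBt (Nat.succ_pos d) (ℓ + 1) a M ρ k s z * gBx z)
      = (cutAt (Nat.succ_pos d) (ℓ + 1) a M ρ k s x * (K x z * (η ^ 2 * gAx z)) + cutBt (Nat.succ_pos d) (ℓ + 1) a M ρ k s x * (K x z * gBx z))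
        + K x z * ((cutAt (Nat.succ_pos d) (ℓ + 1) a M ρ k s z - cutAt (Nat.succ_pos d) (ℓ + 1) a M ρ k s x) * (η ^ 2 * gAx z)
          + (cutBt (Nat.succ_pos d) (ℓ + 1) a M ρ k s z - cutBt (Nat.succ_pos d) (ℓ + 1) a M ρ k s x) * gBx z) := by
    intro z _; ring
  rw [Finset.sum_congr rfl hsplit, Finset.sum_add_distrib, Finset.sum_add_distrib, ← Finset.mul_sum, ← Finset.mul_sum, hA0, hB0,
    ← add_mul, cutA_add_cutB (Nat.succ_pos d) (ℓ + 1) a M ρ k s hx0, one_mul]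

/-! ## §2 The input of region A in the `(−2)`-weighted sup norm -/

open B6Prop22DerivMultiLevelBox (dMat)
open B8CubeMemberBoxDomains (tower_iff_lev_eq le_lev_iff)
open B8Eq191FlatDirichletDepth (mem_cube_of_tower)
open B8Eq1101CubeMemberCutoffs (cut_mem cut_eq_zero_of_not_mem)

/-- `h_A(z) ≠ 0 ⇒ z ∈ □₁`. [cite: Balaban1984PropagatorsII, (2.47) p.231] -/
theorem mem_cube_one_of_cutA_ne_zero (hd : 0 < d) (L : ℕ) (a : Fin d → ℤ) (M ρ : ℕ) {k s : ℕ} (hs : 1 ≤ s) (hk : 1 ≤ k)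
    {z : Fin d → ℤ} (hz : cutA hd L a M ρ k s z ≠ 0) : z ∈ cube L a M ρ k 1 := by
  by_contra h
  exact hz ((cut_eq_zero_of_not_mem hd L a M ρ k hs hk).1 h).1

/-- **REGION A INPUT AND OUTPUT.**  If `u` obeys the consumer's weighted bound `(Lʲη)²|u(z)| ≤ N` on `□_j` (`j ≤ n`), then `uA = (h_Au)(· − t)` obeys r05's
hypothesis `|uA(y)| ≤ (Nη⁻²)·(L^{lev y})⁻²` on the host box (the level of `y` IS the tower level of `y − t`, F1), hence — given the (1.101) package of region A
(F1 `ineq1101_regionA`, constant `C′`) — `η²|(G′uA)(y)| ≤ C′N` and `η²|(∂_μG′uA)(y)| ≤ C′N·(L^{lev y})⁻¹`.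
[cite: Balaban1985RegularSpaces, (1.101) p.93; Balaban1985BackgroundPropagators, Theorem 3.1 (3.42) p.397; Balaban1984PropagatorsII, Prop. 2.2 (2.67) p.234] -/
theorem regionA_bounds {ℓ Mh : ℕ} (hMh : 1 ≤ Mh) (a : Fin (d + 1) → ℤ) {M ρ k n : ℕ} (hn : 1 ≤ n) (hnk : n ≤ k)
    (hρd : Mh * (ℓ + 1) ∣ ρ) (hρ0 : 0 < ρ)
    {η : ℝ} (hη : 0 < η) (aw : ℕ → ℝ) {C' : ℝ}
    (hG : ∀ (f : ↥(boxDom (N0 ℓ Mh n (boxP ℓ M ρ k n))) → ℝ) (S' : ℝ), 0 ≤ S' →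
      (∀ z : ↥(boxDom (N0 ℓ Mh n (boxP ℓ M ρ k n))), |f z| ≤ S' * ((((ℓ : ℝ) + 1) ^ lev ℓ Mh a M ρ k n z.1) ^ 2)⁻¹) →
      ∀ y : ↥(boxDom (N0 ℓ Mh n (boxP ℓ M ρ k n))),
        |(gml (N0 ℓ Mh n (boxP ℓ M ρ k n)) ℓ n (lev ℓ Mh a M ρ k n) aw *ᵥ f) y| ≤ C' * S' ∧
        ∀ μ : Fin (d + 1), |(dMat (N0 ℓ Mh n (boxP ℓ M ρ k n)) μ *ᵥ (gml (N0 ℓ Mh n (boxP ℓ M ρ k n)) ℓ n (lev ℓ Mh a M ρ k n) aw *ᵥ f)) y|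
          ≤ C' * (((ℓ : ℝ) + 1) ^ lev ℓ Mh a M ρ k n y.1)⁻¹ * S')
    {s : ℕ} (hs : 1 ≤ s) (u : (Fin (d + 1) → ℤ) → ℝ) {N : ℝ} (hN : 0 ≤ N)
    (hu : ∀ j, j ≤ n → ∀ z, z ∈ cube (ℓ + 1) a M ρ k j → ((((ℓ + 1 : ℕ) : ℝ)) ^ j * η) ^ 2 * |u z| ≤ N)
    (uA : ↥(boxDom (N0 ℓ Mh n (boxP ℓ M ρ k n))) → ℝ)
    (huA : ∀ y, uA y = cutA (Nat.succ_pos d) (ℓ + 1) a M ρ k s (y.1 - shift ℓ Mh a ρ k n) * u (y.1 - shift ℓ Mh a ρ k n))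
    (y : ↥(boxDom (N0 ℓ Mh n (boxP ℓ M ρ k n)))) :
    η ^ 2 * |(gml (N0 ℓ Mh n (boxP ℓ M ρ k n)) ℓ n (lev ℓ Mh a M ρ k n) aw *ᵥ uA) y| ≤ C' * N ∧
    ∀ μ : Fin (d + 1), η ^ 2 * |(dMat (N0 ℓ Mh n (boxP ℓ M ρ k n)) μ *ᵥ (gml (N0 ℓ Mh n (boxP ℓ M ρ k n)) ℓ n (lev ℓ Mh a M ρ k n) aw *ᵥ uA)) y|
      ≤ C' * N * (((ℓ : ℝ) + 1) ^ lev ℓ Mh a M ρ k n y.1)⁻¹ := by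
  have hL : 1 ≤ ℓ + 1 := Nat.succ_pos ℓ
  have hk : 1 ≤ k := hn.trans hnk
  have hρL : ℓ + 1 ≤ ρ := le_trans (Nat.le_mul_of_pos_left _ hMh) (Nat.le_of_dvd hρ0 hρd)
  have hη2 : 0 < η ^ 2 := by positivity
  have hcast : ((ℓ + 1 : ℕ) : ℝ) = (ℓ : ℝ) + 1 := by push_cast; ring
  -- the input bound
  have huA' : ∀ z : ↥(boxDom (N0 ℓ Mh n (boxP ℓ M ρ k n))),
      |uA z| ≤ N * (η ^ 2)⁻¹ * ((((ℓ : ℝ) + 1) ^ lev ℓ Mh a M ρ k n z.1) ^ 2)⁻¹ := by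
    intro z
    rw [huA z]
    by_cases h0 : cutA (Nat.succ_pos d) (ℓ + 1) a M ρ k s (z.1 - shift ℓ Mh a ρ k n) = 0
    · rw [h0, zero_mul, abs_zero]; positivity
    · have hz1 := mem_cube_one_of_cutA_ne_zero (Nat.succ_pos d) (ℓ + 1) a M ρ hs hk h0
      set j₀ := lev ℓ Mh a M ρ k n z.1 with hj₀
      have hj₀n : j₀ ≤ n := lev_le ℓ Mh a M ρ k hn _
      have hzt : z.1 - shift ℓ Mh a ρ k n + shift ℓ Mh a ρ k n = z.1 := sub_add_cancel _ _
      have htower : blockMap ((ℓ + 1) ^ j₀) (z.1 - shift ℓ Mh a ρ k n) ∈ cubeLamS (ℓ + 1) a M ρ k n j₀ := by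
        rw [tower_iff_lev_eq a M hρL hn hnk hj₀n hz1 (Mh := Mh), hzt]
      have hzj : z.1 - shift ℓ Mh a ρ k n ∈ cube (ℓ + 1) a M ρ k j₀ := mem_cube_of_tower hL a M ρ htower
      have hb := hu j₀ hj₀n _ hzj
      rw [hcast] at hb
      have hc := (cut_mem (Nat.succ_pos d) (ℓ + 1) a M ρ k s (z.1 - shift ℓ Mh a ρ k n)).1
      rw [abs_mul, abs_of_nonneg hc.1]
      have hpow : 0 < (((ℓ : ℝ) + 1) ^ j₀) ^ 2 := by positivity
      calc cutA (Nat.succ_pos d) (ℓ + 1) a M ρ k s (z.1 - shift ℓ Mh a ρ k n) * |u (z.1 - shift ℓ Mh a ρ k n)|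
          ≤ 1 * |u (z.1 - shift ℓ Mh a ρ k n)| := mul_le_mul_of_nonneg_right hc.2 (abs_nonneg _)
        _ ≤ N * (η ^ 2)⁻¹ * ((((ℓ : ℝ) + 1) ^ j₀) ^ 2)⁻¹ := by
            rw [one_mul, mul_assoc, ← mul_inv, le_mul_inv_iff₀ (by positivity)]
            calc |u (z.1 - shift ℓ Mh a ρ k n)| * (η ^ 2 * (((ℓ : ℝ) + 1) ^ j₀) ^ 2)
                = (((ℓ : ℝ) + 1) ^ j₀ * η) ^ 2 * |u (z.1 - shift ℓ Mh a ρ k n)| := by ring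
              _ ≤ N := hb
  obtain ⟨h1, h2⟩ := hG uA (N * (η ^ 2)⁻¹) (by positivity) huA' y
  constructor
  · calc η ^ 2 * |(gml (N0 ℓ Mh n (boxP ℓ M ρ k n)) ℓ n (lev ℓ Mh a M ρ k n) aw *ᵥ uA) y|
        ≤ η ^ 2 * (C' * (N * (η ^ 2)⁻¹)) := mul_le_mul_of_nonneg_left h1 hη2.le
      _ = C' * N := by field_simp
  · intro μ
    calc η ^ 2 * |(dMat (N0 ℓ Mh n (boxP ℓ M ρ k n)) μ *ᵥ (gml (N0 ℓ Mh n (boxP ℓ M ρ k n)) ℓ n (lev ℓ Mh a M ρ k n) aw *ᵥ uA)) y|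
        ≤ η ^ 2 * (C' * (((ℓ : ℝ) + 1) ^ lev ℓ Mh a M ρ k n y.1)⁻¹ * (N * (η ^ 2)⁻¹)) := mul_le_mul_of_nonneg_left (h2 μ) hη2.le
      _ = C' * N * (((ℓ : ℝ) + 1) ^ lev ℓ Mh a M ρ k n y.1)⁻¹ := by field_simp

/-! ## §3 The input and output of region B (the wall) -/

open B8Eq1101CubeMemberCutoffs (wall_hfull wall_hdisj wall_hcover wall_hlow)
open B8Eq191FlatDirichletWall (wall_rowBound one_le_c0)

open Classical in
/-- **REGION B OUTPUT.**  With the wall outside `□₂` (`m_W + (d+1)ℓ ≤ ρL`), normalised weights `a′_j ∈ [a₀, 8]` (`2 ≤ a₀ ≤ 8`) and the consumer's weighted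
bound on `u`, the wall field `gB = (K|_W)⁻¹(h_Bu)` satisfies `|gB| ≤ (2L²∕a₀)·c₀((2(d+1)L)⁻¹)^{d+1}·N` (F3 `wall_rowBound` at `θ = ½`, `δ′ = 1∕(2(d+1))`).
[cite: Balaban1985RegularSpaces, (1.101) p.93, p.98; Balaban1984PropagatorsII, p.228, Lemma 2.1 (2.61) p.234] -/
theorem regionB_bound {ℓ : ℕ} (a : Fin (d + 1) → ℤ) (M : ℕ) {ρ k n : ℕ} (hρL : ℓ + 1 ≤ ρ) (hnk : n ≤ k)
    {η : ℝ} (hη : η ≠ 0) (w : ℕ → ℝ) (hwpos : ∀ j, 0 < w j)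
    (K : (Fin (d + 1) → ℤ) → (Fin (d + 1) → ℤ) → ℝ)
    (hK : ∀ x z, K x z = ((η ^ 2)⁻¹ * ∑ μ : Fin (d + 1), ((2 : ℝ) * (if z = x then (1 : ℝ) else 0) - (if z = x + e μ then (1 : ℝ) else 0)
        - (if z = x - e μ then (1 : ℝ) else 0))) +
        (∑ j ∈ Finset.range (n + 1), (if blockMap ((ℓ + 1) ^ j) x ∈ cubeLamS (ℓ + 1) a M ρ k n j ∧
            blockMap ((ℓ + 1) ^ j) z = blockMap ((ℓ + 1) ^ j) x then
          w j * (((((ℓ + 1 : ℕ) : ℝ) ^ (d + 1))⁻¹) ^ j) ^ 2 else 0)))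
    (S : Finset (Fin (d + 1) → ℤ)) (hS : ∀ z, z ∈ S ↔ z ∈ cubeFam false (ℓ + 1) a M ρ k 0)
    {a₀ : ℝ} (ha₀ : 2 ≤ a₀) (ha₀8 : a₀ ≤ 8)
    (hlo : ∀ j, j ≤ n → a₀ ≤ w j * η ^ 2 * (((ℓ + 1 : ℕ) : ℝ) ^ j) ^ 2 * (((((ℓ + 1 : ℕ) : ℝ)) ^ (d + 1)) ^ j)⁻¹)
    (hhi : ∀ j, j ≤ n → w j * η ^ 2 * (((ℓ + 1 : ℕ) : ℝ) ^ j) ^ 2 * (((((ℓ + 1 : ℕ) : ℝ)) ^ (d + 1)) ^ j)⁻¹ ≤ 8)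
    {s mW : ℕ} (hmWρ : (mW : ℤ) + (d + 1 : ℕ) * ((ℓ + 1 : ℕ) - 1 : ℤ) ≤ ρ * (ℓ + 1 : ℕ))
    (u : (Fin (d + 1) → ℤ) → ℝ) {N : ℝ} (hN : 0 ≤ N)
    (hu : ∀ j, j ≤ n → ∀ z, z ∈ cube (ℓ + 1) a M ρ k j → ((((ℓ + 1 : ℕ) : ℝ)) ^ j * η) ^ 2 * |u z| ≤ N)
    (uB : ↥(wall (Nat.succ_pos d) (ℓ + 1) a M ρ k S mW) → ℝ) (huB : ∀ y, uB y = cutB (Nat.succ_pos d) (ℓ + 1) a M ρ k s y.1 * u y.1)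
    (y : ↥(wall (Nat.succ_pos d) (ℓ + 1) a M ρ k S mW)) :
    |(((Matrix.of fun x z : ↥(wall (Nat.succ_pos d) (ℓ + 1) a M ρ k S mW) => K x.1 z.1)⁻¹) *ᵥ uB) y|
      ≤ (((ℓ + 1 : ℕ) : ℝ)) ^ 2 / (a₀ * (1 - 1 / 2)) * B6.c0 1 (1 / (2 * ((d : ℝ) + 1)) / ((ℓ + 1 : ℕ) : ℝ)) ^ (d + 1) * N := by
  have hL : 1 ≤ ℓ + 1 := Nat.succ_pos ℓ
  have hd : 0 < d + 1 := Nat.succ_pos d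
  -- the input bound `|uB| ≤ Nη⁻²` (the level-0 reading of the weighted bound on `□₀`)
  have huB' : ∀ z ∈ wall (Nat.succ_pos d) (ℓ + 1) a M ρ k S mW, |(fun z => cutB (Nat.succ_pos d) (ℓ + 1) a M ρ k s z * u z) z| ≤ N * (η ^ 2)⁻¹ := by
    intro z hz
    have hzS : z ∈ S := wall_subset (Nat.succ_pos d) (ℓ + 1) a M ρ k S mW hz
    have hz0 : z ∈ cube (ℓ + 1) a M ρ k 0 := by rw [← cubeFam_false_of_le (ℓ + 1) a M ρ (Nat.zero_le k)]; exact (hS z).mp hzS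
    have hb := hu 0 (Nat.zero_le n) z hz0
    rw [pow_zero, one_mul] at hb
    have hc := (cut_mem (Nat.succ_pos d) (ℓ + 1) a M ρ k s z).2.2.1
    dsimp only
    rw [abs_mul, abs_of_nonneg hc.1]
    have hη2 : 0 < η ^ 2 := by positivity
    calc cutB (Nat.succ_pos d) (ℓ + 1) a M ρ k s z * |u z| ≤ 1 * |u z| := mul_le_mul_of_nonneg_right hc.2 (abs_nonneg _)
      _ ≤ N * (η ^ 2)⁻¹ := by rw [one_mul, le_mul_inv_iff₀ hη2, mul_comm]; exact hb
  have hrow := wall_rowBound hd hη hL n (cubeLamS (ℓ + 1) a M ρ k n) w hwpos K hK (wall (Nat.succ_pos d) (ℓ + 1) a M ρ k S mW)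
    (wall_hfull hd hL a M hρL hnk S hS mW hmWρ) (wall_hdisj hd hL a M hρL hnk S hS mW) (wall_hcover hd hL a M hρL hnk S hS mW)
    (wall_hlow hd hL a M hρL hnk S mW hmWρ) (lt_of_lt_of_le (by norm_num) ha₀) ha₀8 hlo hhi
    (δ' := 1 / (2 * ((d : ℝ) + 1))) (θ := 1 / 2) (by positivity) ?_ ?_ ?_ ?_ (by norm_num)
    (fun z => cutB (Nat.succ_pos d) (ℓ + 1) a M ρ k s z * u z) hN huB' y
  · have heq : ∑ z : ↥(wall (Nat.succ_pos d) (ℓ + 1) a M ρ k S mW),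
        ((Matrix.of fun x z : ↥(wall (Nat.succ_pos d) (ℓ + 1) a M ρ k S mW) => K x.1 z.1)⁻¹) y z
          * (fun z => cutB (Nat.succ_pos d) (ℓ + 1) a M ρ k s z * u z) z.1
        = (((Matrix.of fun x z : ↥(wall (Nat.succ_pos d) (ℓ + 1) a M ρ k S mW) => K x.1 z.1)⁻¹) *ᵥ uB) y := by
      rw [Matrix.mulVec, dotProduct]
      exact Finset.sum_congr rfl fun z _ => by rw [huB z]
    rw [← heq]
    have hd1 : ((d + 1 : ℕ) : ℝ) = (d : ℝ) + 1 := by push_cast; ring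
    simpa [hd1] using hrow
  -- the four numeric side conditions of brick 3 at `δ′ = 1/(2(d+1))`, `θ = ½`
  · have : (0 : ℝ) < (d : ℝ) + 1 := by positivity
    rw [div_le_one (by positivity)]; linarith
  · have hd1 : ((d + 1 : ℕ) : ℝ) = (d : ℝ) + 1 := by push_cast; ring
    rw [hd1]; field_simp; linarith
  · have hd1 : ((d + 1 : ℕ) : ℝ) = (d : ℝ) + 1 := by push_cast; ring
    have hD : (1 : ℝ) ≤ (d : ℝ) + 1 := by linarith [Nat.cast_nonneg (α := ℝ) d]
    rw [hd1]
    have : 4 * ((d : ℝ) + 1) * (1 / (2 * ((d : ℝ) + 1))) ^ 2 = 1 / ((d : ℝ) + 1) := by field_simp; ring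
    rw [this, div_le_iff₀ (by positivity)]
    nlinarith
  · have hd1 : ((d + 1 : ℕ) : ℝ) = (d : ℝ) + 1 := by push_cast; ring
    rw [hd1]
    have : 2 * ((d : ℝ) + 1) ^ 2 * (1 / (2 * ((d : ℝ) + 1))) ^ 2 = 1 / 2 := by field_simp
    rw [this]

/-! ## §4 The size of `P u` and of the commutator `K₁u` -/

open B8Eq1101CubeMemberCutoffs (cut_lipschitz cutAt_eq_of_depth cutBt_facts abs_depth_sub_step_le abs_depth_sub_le_l1dist l1dist_le_of_blockMap_eq)
open B8Eq191FlatDirichletWall (abs_l1dist_step_le l1dist_self)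
open B8Eq191FlatDirichletDepth (depth_ge_of_mem_inner mem_cube_of_le_tower)
open B8Eq191FlatDirichletCoercive (towerBlock_subset_cube block_eq_image)
open B8Eq191FlatDirichletConjugation (cover_cubeMember)
open B8Eq191FlatLettersCubeMember (towers_disjoint_cube cubeFam_antitone)

/-- **`|P u| ≤ A + B`** where `A` bounds `η²|gAx|` and `B` bounds `|gBx|`. [cite: Balaban1984PropagatorsII, (2.50)–(2.51) p.232] -/
theorem parametrix_sup (hd : 0 < d) (L : ℕ) (a : Fin d → ℤ) (M ρ k s : ℕ) {η : ℝ} (gAx gBx : (Fin d → ℤ) → ℝ) {A B : ℝ}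
    (hA : ∀ z, η ^ 2 * |gAx z| ≤ A) (hB : ∀ z, |gBx z| ≤ B) (x : Fin d → ℤ) :
    |cutAt hd L a M ρ k s x * (η ^ 2 * gAx x) + cutBt hd L a M ρ k s x * gBx x| ≤ A + B := by
  obtain ⟨-, hAt, -, hBt⟩ := cut_mem hd L a M ρ k s x
  have h1 : |cutAt hd L a M ρ k s x * (η ^ 2 * gAx x)| ≤ A := by
    rw [abs_mul, abs_of_nonneg hAt.1, abs_mul, abs_of_nonneg (sq_nonneg η)]
    calc cutAt hd L a M ρ k s x * (η ^ 2 * |gAx x|) ≤ 1 * (η ^ 2 * |gAx x|) :=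
          mul_le_mul_of_nonneg_right hAt.2 (by positivity)
      _ ≤ A := by rw [one_mul]; exact hA x
  have h2 : |cutBt hd L a M ρ k s x * gBx x| ≤ B := by
    rw [abs_mul, abs_of_nonneg hBt.1]
    calc cutBt hd L a M ρ k s x * |gBx x| ≤ 1 * |gBx x| := mul_le_mul_of_nonneg_right hBt.2 (abs_nonneg _)
      _ ≤ B := by rw [one_mul]; exact hB x
  exact (abs_add_le _ _).trans (add_le_add h1 h2)

open Classical in
/-- A row of `|K|` against a nonnegative function: `Σ_{z∈S}|K(x,z)|φ(z) ≤ η⁻²Σ_μ(2φ(x) + φ(x+e_μ) + φ(x−e_μ)) + Σ_j[Bʲ(x)∈Λs j]·w_jL^{−2(d+1)j}·Σ_{z∈S,Bʲ(z)=Bʲ(x)}φ(z)`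
(any finite `S`, no interior hypothesis). [cite: Balaban1985RegularSpaces, (1.91) p.91; Balaban1984PropagatorsII, (2.13)–(2.14) p.225] -/
theorem abs_row_le {η : ℝ} (L m : ℕ) (Λs : ℕ → Set (Fin (d + 1) → ℤ)) (w : ℕ → ℝ) (hw0 : ∀ j, 0 ≤ w j)
    (K : (Fin (d + 1) → ℤ) → (Fin (d + 1) → ℤ) → ℝ)
    (hK : ∀ x z, K x z = ((η ^ 2)⁻¹ * ∑ μ : Fin (d + 1), ((2 : ℝ) * (if z = x then (1 : ℝ) else 0) - (if z = x + e μ then (1 : ℝ) else 0)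
        - (if z = x - e μ then (1 : ℝ) else 0))) +
        (∑ j ∈ Finset.range (m + 1), (if blockMap (L ^ j) x ∈ Λs j ∧ blockMap (L ^ j) z = blockMap (L ^ j) x then
          w j * ((((L : ℝ) ^ (d + 1))⁻¹) ^ j) ^ 2 else 0)))
    (S : Finset (Fin (d + 1) → ℤ)) (x : Fin (d + 1) → ℤ) (φ : (Fin (d + 1) → ℤ) → ℝ) (hφ : ∀ z, 0 ≤ φ z) :
    ∑ z ∈ S, |K x z| * φ z
      ≤ (η ^ 2)⁻¹ * ∑ μ : Fin (d + 1), (2 * φ x + φ (x + e μ) + φ (x - e μ))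
        + ∑ j ∈ Finset.range (m + 1), (if blockMap (L ^ j) x ∈ Λs j then
            w j * ((((L : ℝ) ^ (d + 1))⁻¹) ^ j) ^ 2 * ∑ z ∈ S.filter (fun z => blockMap (L ^ j) z = blockMap (L ^ j) x), φ z else 0) := by
  have hη : 0 ≤ (η ^ 2)⁻¹ := by positivity
  -- termwise bound on `|K(x,z)|`
  have hKabs : ∀ z, |K x z| ≤ (η ^ 2)⁻¹ * ∑ μ : Fin (d + 1), ((2 : ℝ) * (if z = x then (1 : ℝ) else 0) + (if z = x + e μ then (1 : ℝ) else 0)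
        + (if z = x - e μ then (1 : ℝ) else 0)) +
        (∑ j ∈ Finset.range (m + 1), (if blockMap (L ^ j) x ∈ Λs j ∧ blockMap (L ^ j) z = blockMap (L ^ j) x then
          w j * ((((L : ℝ) ^ (d + 1))⁻¹) ^ j) ^ 2 else 0)) := by
    intro z
    rw [hK]
    refine (abs_add_le _ _).trans (add_le_add ?_ (le_of_eq (abs_of_nonneg (Finset.sum_nonneg fun j _ => ?_))))
    · rw [abs_mul, abs_of_nonneg hη]
      refine mul_le_mul_of_nonneg_left ((Finset.abs_sum_le_sum_abs _ _).trans (Finset.sum_le_sum fun μ _ => ?_)) hη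
      have h1 : (0 : ℝ) ≤ (if z = x then (1 : ℝ) else 0) := by split_ifs <;> norm_num
      have h2 : (0 : ℝ) ≤ (if z = x + e μ then (1 : ℝ) else 0) := by split_ifs <;> norm_num
      have h3 : (0 : ℝ) ≤ (if z = x - e μ then (1 : ℝ) else 0) := by split_ifs <;> norm_num
      rw [abs_le]; constructor <;> linarith
    · split_ifs
      · exact mul_nonneg (hw0 j) (by positivity)
      · exact le_rfl
  -- sum the termwise bound
  have hstep : ∑ z ∈ S, |K x z| * φ z ≤ ∑ z ∈ S, ((η ^ 2)⁻¹ * ∑ μ : Fin (d + 1), ((2 : ℝ) * (if z = x then (1 : ℝ) else 0)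
        + (if z = x + e μ then (1 : ℝ) else 0) + (if z = x - e μ then (1 : ℝ) else 0)) +
        (∑ j ∈ Finset.range (m + 1), (if blockMap (L ^ j) x ∈ Λs j ∧ blockMap (L ^ j) z = blockMap (L ^ j) x then
          w j * ((((L : ℝ) ^ (d + 1))⁻¹) ^ j) ^ 2 else 0))) * φ z :=
    Finset.sum_le_sum fun z _ => mul_le_mul_of_nonneg_right (hKabs z) (hφ z)
  have hsplit : ∑ z ∈ S, ((η ^ 2)⁻¹ * ∑ μ : Fin (d + 1), ((2 : ℝ) * (if z = x then (1 : ℝ) else 0)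
        + (if z = x + e μ then (1 : ℝ) else 0) + (if z = x - e μ then (1 : ℝ) else 0)) +
        (∑ j ∈ Finset.range (m + 1), (if blockMap (L ^ j) x ∈ Λs j ∧ blockMap (L ^ j) z = blockMap (L ^ j) x then
          w j * ((((L : ℝ) ^ (d + 1))⁻¹) ^ j) ^ 2 else 0))) * φ z
      = ∑ z ∈ S, ((η ^ 2)⁻¹ * ∑ μ : Fin (d + 1), (((2 : ℝ) * (if z = x then (1 : ℝ) else 0)) * φ z
          + (if z = x + e μ then (1 : ℝ) else 0) * φ z + (if z = x - e μ then (1 : ℝ) else 0) * φ z)) +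
        ∑ z ∈ S, (∑ j ∈ Finset.range (m + 1), (if blockMap (L ^ j) x ∈ Λs j ∧ blockMap (L ^ j) z = blockMap (L ^ j) x then
          w j * ((((L : ℝ) ^ (d + 1))⁻¹) ^ j) ^ 2 else 0) * φ z) := by
    rw [← Finset.sum_add_distrib]
    refine Finset.sum_congr rfl fun z _ => ?_
    rw [add_mul, mul_assoc, Finset.sum_mul, Finset.sum_mul]
    congr 2
    refine Finset.sum_congr rfl fun μ _ => ?_
    ring
  have hlap : ∑ z ∈ S, ((η ^ 2)⁻¹ * ∑ μ : Fin (d + 1), (((2 : ℝ) * (if z = x then (1 : ℝ) else 0)) * φ z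
          + (if z = x + e μ then (1 : ℝ) else 0) * φ z + (if z = x - e μ then (1 : ℝ) else 0) * φ z))
      ≤ (η ^ 2)⁻¹ * ∑ μ : Fin (d + 1), (2 * φ x + φ (x + e μ) + φ (x - e μ)) := by
    rw [← Finset.mul_sum, Finset.sum_comm]
    refine mul_le_mul_of_nonneg_left (Finset.sum_le_sum fun μ _ => ?_) hη
    rw [Finset.sum_add_distrib, Finset.sum_add_distrib]
    have hind : ∀ (y : Fin (d + 1) → ℤ), ∑ z ∈ S, (if z = y then (1 : ℝ) else 0) * φ z ≤ φ y := by
      intro y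
      rw [show (∑ z ∈ S, (if z = y then (1 : ℝ) else 0) * φ z) = ∑ z ∈ S, (if z = y then φ z else 0) from
        Finset.sum_congr rfl fun z _ => by split_ifs <;> simp, Finset.sum_ite_eq' S y]
      split_ifs
      · exact le_rfl
      · exact hφ y
    have h1 := hind (x + e μ)
    have h2 := hind (x - e μ)
    have h0' : ∑ z ∈ S, 2 * (if z = x then (1 : ℝ) else 0) * φ z ≤ 2 * φ x := by
      rw [show (∑ z ∈ S, 2 * (if z = x then (1 : ℝ) else 0) * φ z) = 2 * ∑ z ∈ S, (if z = x then (1 : ℝ) else 0) * φ z by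
        rw [Finset.mul_sum]; exact Finset.sum_congr rfl fun z _ => by ring]
      linarith [hind x]
    linarith
  have havg : ∑ z ∈ S, (∑ j ∈ Finset.range (m + 1), (if blockMap (L ^ j) x ∈ Λs j ∧ blockMap (L ^ j) z = blockMap (L ^ j) x then
          w j * ((((L : ℝ) ^ (d + 1))⁻¹) ^ j) ^ 2 else 0) * φ z)
      = ∑ j ∈ Finset.range (m + 1), (if blockMap (L ^ j) x ∈ Λs j then
            w j * ((((L : ℝ) ^ (d + 1))⁻¹) ^ j) ^ 2 * ∑ z ∈ S.filter (fun z => blockMap (L ^ j) z = blockMap (L ^ j) x), φ z else 0) := by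
    rw [Finset.sum_comm]
    refine Finset.sum_congr rfl fun j _ => ?_
    by_cases hj : blockMap (L ^ j) x ∈ Λs j
    · rw [if_pos hj, Finset.mul_sum, Finset.sum_filter]
      refine Finset.sum_congr rfl fun z _ => ?_
      by_cases hz : blockMap (L ^ j) z = blockMap (L ^ j) x
      · rw [if_pos ⟨hj, hz⟩, if_pos hz]
      · rw [if_neg (fun h => hz h.2), if_neg hz, zero_mul]
    · rw [if_neg hj]
      exact Finset.sum_eq_zero fun z _ => by rw [if_neg (fun h => hj h.1), zero_mul]
  rw [hsplit, havg] at hstep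
  linarith [hlap]

open B8Eq191FlatDirichletDepth (not_mem_cube_of_tower_lt)
open B8Eq1101CubeMemberCutoffs (blockMap_pow_zero)

/-- A block of side `ℓ + 1` lying in `S` has at most `(ℓ+1)^{d+1}` sites of `S`. [folklore] [cite: Balaban1985RegularSpaces, p.79] -/
theorem card_filter_block_le (ℓ : ℕ) (S : Finset (Fin (d + 1) → ℤ)) (x : Fin (d + 1) → ℤ)
    (hfull : ∀ z, blockMap (ℓ + 1) z = blockMap (ℓ + 1) x → z ∈ S) :
    (S.filter (fun z => blockMap (ℓ + 1) z = blockMap (ℓ + 1) x)).card ≤ (ℓ + 1) ^ (d + 1) := by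
  classical
  have hB : ∀ z, z ∈ S.filter (fun z => blockMap (ℓ + 1) z = blockMap (ℓ + 1) x) ↔ blockMap (ℓ + 1) z = blockMap (ℓ + 1) x := by
    intro z
    rw [Finset.mem_filter]
    exact ⟨fun h => h.2, fun h => ⟨hfull z h, h⟩⟩
  rw [block_eq_image ℓ (blockMap (ℓ + 1) x) _ hB]
  refine (Finset.card_image_le).trans ?_
  rw [Finset.card_univ, Fintype.card_pi, Finset.prod_const, Fintype.card_fin, Finset.card_univ, Fintype.card_fin]

open Classical in
/-- **THE COMMUTATOR IS SMALL IN THE `(−2)`-WEIGHTED SUP NORM.**  With `A ≥ η²|gAx|`, `B ≥ |gBx|` (`gBx = 0` off `□₀`), ramp length `s ≥ 1` and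
`4s ≤ ρL`: for every `x ∈ □_j` (`j ≤ n`),
`(Lʲη)²·|Σ_{z∈□₀} K(x,z)((h̃_A(z) − h̃_A(x))η²gAx(z) + (h̃_B(z) − h̃_B(x))gBx(z))| ≤ 10(d+1)L²(A + B)∕s`.
Mechanism: at a site of tower level `≥ 2` every entry of the row vanishes (the site, its neighbours and its tower block are deeper than `4s` into `□₁`, where
`h̃_A ≡ 1`, `h̃_B ≡ 0`); at a site of level `≤ 1` the row has `2(d+1)` neighbour entries `η⁻²` against differences `≤ 1∕s`, and at most `L^{d+1}` block
entries `η⁻²a₁L^{−2}L^{−(d+1)}` against differences `≤ (d+1)(L−1)∕s` (the cutoffs are `1∕s`-Lipschitz in `|·|₁`), and the weight is `≤ (Lη)²`.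
[cite: Balaban1984PropagatorsII, (2.52)–(2.55) p.232–233 («the norms of the operators … are small for M sufficiently large»), (2.48) p.231; Balaban1985RegularSpaces, (1.101) p.93] -/
theorem commutator_bound {ℓ Mh : ℕ} (hMh : 1 ≤ Mh) (a : Fin (d + 1) → ℤ) {M ρ k n : ℕ} (hn : 1 ≤ n) (hnk : n ≤ k)
    (hρd : Mh * (ℓ + 1) ∣ ρ) (hρ0 : 0 < ρ)
    {η : ℝ} (hη : η ≠ 0) (w aw : ℕ → ℝ) (hw0 : ∀ j, 0 ≤ w j) (haw0 : 0 ≤ aw 1) (haw8 : aw 1 ≤ 8)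
    (hw : ∀ j, 1 ≤ j → j ≤ n → w j * (((((ℓ + 1 : ℕ) : ℝ) ^ (d + 1))⁻¹) ^ j) ^ 2 = (η ^ 2)⁻¹ * levC d ℓ aw j)
    (K : (Fin (d + 1) → ℤ) → (Fin (d + 1) → ℤ) → ℝ)
    (hK : ∀ x z, K x z = ((η ^ 2)⁻¹ * ∑ μ : Fin (d + 1), ((2 : ℝ) * (if z = x then (1 : ℝ) else 0) - (if z = x + e μ then (1 : ℝ) else 0)
        - (if z = x - e μ then (1 : ℝ) else 0))) +
        (∑ j ∈ Finset.range (n + 1), (if blockMap ((ℓ + 1) ^ j) x ∈ cubeLamS (ℓ + 1) a M ρ k n j ∧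
            blockMap ((ℓ + 1) ^ j) z = blockMap ((ℓ + 1) ^ j) x then
          w j * (((((ℓ + 1 : ℕ) : ℝ) ^ (d + 1))⁻¹) ^ j) ^ 2 else 0)))
    (S : Finset (Fin (d + 1) → ℤ)) (hS : ∀ z, z ∈ S ↔ z ∈ cubeFam false (ℓ + 1) a M ρ k 0)
    {s : ℕ} (hs : 1 ≤ s) (hρs : 4 * (s : ℤ) ≤ ρ * (ℓ + 1 : ℕ))
    (gAx gBx : (Fin (d + 1) → ℤ) → ℝ) {A B : ℝ} (hA0 : 0 ≤ A) (hB0 : 0 ≤ B) (hA : ∀ z, η ^ 2 * |gAx z| ≤ A) (hB : ∀ z, |gBx z| ≤ B)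
    (hgBx0 : ∀ z, z ∉ S → gBx z = 0)
    {x : Fin (d + 1) → ℤ} (hx : x ∈ S) {j : ℕ} (hj : j ≤ n) (hxj : x ∈ cube (ℓ + 1) a M ρ k j) :
    ((((ℓ + 1 : ℕ) : ℝ)) ^ j * η) ^ 2 *
      |∑ z ∈ S, K x z * ((cutAt (Nat.succ_pos d) (ℓ + 1) a M ρ k s z - cutAt (Nat.succ_pos d) (ℓ + 1) a M ρ k s x) * (η ^ 2 * gAx z)
        + (cutBt (Nat.succ_pos d) (ℓ + 1) a M ρ k s z - cutBt (Nat.succ_pos d) (ℓ + 1) a M ρ k s x) * gBx z)|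
      ≤ 10 * ((d : ℝ) + 1) * (((ℓ + 1 : ℕ) : ℝ)) ^ 2 * (A + B) / s := by
  have hd : 0 < d + 1 := Nat.succ_pos d
  have hL : 1 ≤ ℓ + 1 := Nat.succ_pos ℓ
  have hk : 1 ≤ k := hn.trans hnk
  have hρL : ℓ + 1 ≤ ρ := le_trans (Nat.le_mul_of_pos_left _ hMh) (Nat.le_of_dvd hρ0 hρd)
  have hLr : (1 : ℝ) ≤ ((ℓ + 1 : ℕ) : ℝ) := by exact_mod_cast hL
  have hs0 : (0 : ℝ) < s := by exact_mod_cast hs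
  have hx0 : x ∈ cube (ℓ + 1) a M ρ k 0 := by rw [← cubeFam_false_of_le (ℓ + 1) a M ρ (Nat.zero_le k)]; exact (hS x).mp hx
  have hxF : x ∈ cubeFam false (ℓ + 1) a M ρ k 0 := (hS x).mp hx
  -- the commutator integrand and its pointwise bound
  set c : (Fin (d + 1) → ℤ) → ℝ := fun z => (cutAt hd (ℓ + 1) a M ρ k s z - cutAt hd (ℓ + 1) a M ρ k s x) * (η ^ 2 * gAx z)
      + (cutBt hd (ℓ + 1) a M ρ k s z - cutBt hd (ℓ + 1) a M ρ k s x) * gBx z with hc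
  have hcx : c x = 0 := by simp only [hc, sub_self, zero_mul, add_zero]
  have hcle : ∀ z, |c z| ≤ (l1dist z x : ℝ) / s * (A + B) := by
    intro z
    obtain ⟨-, hlipA, hlipB⟩ := cut_lipschitz hd (ℓ + 1) a M ρ k hs z x
    have hl0 : (0 : ℝ) ≤ (l1dist z x : ℝ) / s := div_nonneg (by exact_mod_cast B8Eq191FlatDirichletWall.l1dist_nonneg z x) hs0.le
    have h1 : |(cutAt hd (ℓ + 1) a M ρ k s z - cutAt hd (ℓ + 1) a M ρ k s x) * (η ^ 2 * gAx z)| ≤ (l1dist z x : ℝ) / s * A := by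
      rw [abs_mul, abs_mul, abs_of_nonneg (sq_nonneg η)]
      exact mul_le_mul hlipA (hA z) (by positivity) hl0
    have h2 : |(cutBt hd (ℓ + 1) a M ρ k s z - cutBt hd (ℓ + 1) a M ρ k s x) * gBx z| ≤ (l1dist z x : ℝ) / s * B := by
      by_cases hzS : z ∈ S
      · have hz0 : z ∈ cube (ℓ + 1) a M ρ k 0 := by rw [← cubeFam_false_of_le (ℓ + 1) a M ρ (Nat.zero_le k)]; exact (hS z).mp hzS
        rw [abs_mul]
        exact mul_le_mul (hlipB hz0 hx0).2 (hB z) (abs_nonneg _) hl0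
      · rw [hgBx0 z hzS, mul_zero, abs_zero]; positivity
    calc |c z| ≤ |(cutAt hd (ℓ + 1) a M ρ k s z - cutAt hd (ℓ + 1) a M ρ k s x) * (η ^ 2 * gAx z)|
          + |(cutBt hd (ℓ + 1) a M ρ k s z - cutBt hd (ℓ + 1) a M ρ k s x) * gBx z| := abs_add_le _ _
      _ ≤ (l1dist z x : ℝ) / s * A + (l1dist z x : ℝ) / s * B := add_le_add h1 h2
      _ = (l1dist z x : ℝ) / s * (A + B) := by ring
  -- deep sites: the integrand vanishes at sites of depth `≥ ρL`
  have hdeep : ∀ z, (ρ : ℤ) * (ℓ + 1 : ℕ) ≤ depth hd (ℓ + 1) a M ρ k 1 z → (ρ : ℤ) * (ℓ + 1 : ℕ) ≤ depth hd (ℓ + 1) a M ρ k 1 x → c z = 0 := by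
    intro z hz hxd
    have h1 : cutAt hd (ℓ + 1) a M ρ k s z = 1 := (cutAt_eq_of_depth hd (ℓ + 1) a M ρ k hs z).1 (by linarith)
    have h2 : cutAt hd (ℓ + 1) a M ρ k s x = 1 := (cutAt_eq_of_depth hd (ℓ + 1) a M ρ k hs x).1 (by linarith)
    have h3 : cutBt hd (ℓ + 1) a M ρ k s z = 0 := (cutBt_facts hd (ℓ + 1) a M ρ k hs z).2.2.1 (by linarith)
    have h4 : cutBt hd (ℓ + 1) a M ρ k s x = 0 := (cutBt_facts hd (ℓ + 1) a M ρ k hs x).2.2.1 (by linarith)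
    simp only [hc, h1, h2, h3, h4, sub_self, zero_mul, add_zero]
  -- the row bound of §4
  have hrow := abs_row_le (ℓ + 1) n (cubeLamS (ℓ + 1) a M ρ k n) w hw0 K (by simpa using hK) S x (fun z => |c z|) (fun z => abs_nonneg _)
  have habs : |∑ z ∈ S, K x z * c z| ≤ ∑ z ∈ S, |K x z| * |c z| :=
    (Finset.abs_sum_le_sum_abs _ _).trans (le_of_eq (Finset.sum_congr rfl fun z _ => abs_mul _ _))
  -- the tower level of `x`
  obtain ⟨J, hJn, hxJ⟩ := cover_cubeMember hL a M hρL hnk x hxF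
  -- collapse of the level sum to `J`
  have hcollapse : ∀ j' ∈ Finset.range (n + 1),
      (if blockMap ((ℓ + 1) ^ j') x ∈ cubeLamS (ℓ + 1) a M ρ k n j' then
        w j' * (((((ℓ + 1 : ℕ) : ℝ)) ^ (d + 1))⁻¹ ^ j') ^ 2 *
          ∑ z ∈ S.filter (fun z => blockMap ((ℓ + 1) ^ j') z = blockMap ((ℓ + 1) ^ j') x), |c z| else 0)
      ≤ if j' = J then w J * (((((ℓ + 1 : ℕ) : ℝ)) ^ (d + 1))⁻¹ ^ J) ^ 2 *
          ∑ z ∈ S.filter (fun z => blockMap ((ℓ + 1) ^ J) z = blockMap ((ℓ + 1) ^ J) x), |c z| else 0 := by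
    intro j' hj'
    have hj'n : j' ≤ n := Nat.lt_succ_iff.mp (Finset.mem_range.mp hj')
    by_cases h : blockMap ((ℓ + 1) ^ j') x ∈ cubeLamS (ℓ + 1) a M ρ k n j'
    · have hjj : j' = J := (towers_disjoint_cube hL a M hρL hnk j' hj'n J hJn _ h _ hxJ x hxF rfl rfl).1
      subst hjj
      rw [if_pos h, if_pos rfl]
    · rw [if_neg h]
      split_ifs
      · exact mul_nonneg (mul_nonneg (hw0 J) (by positivity)) (Finset.sum_nonneg fun z _ => abs_nonneg _)
      · exact le_rfl
  have hlevel : ∑ j' ∈ Finset.range (n + 1),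
      (if blockMap ((ℓ + 1) ^ j') x ∈ cubeLamS (ℓ + 1) a M ρ k n j' then
        w j' * (((((ℓ + 1 : ℕ) : ℝ)) ^ (d + 1))⁻¹ ^ j') ^ 2 *
          ∑ z ∈ S.filter (fun z => blockMap ((ℓ + 1) ^ j') z = blockMap ((ℓ + 1) ^ j') x), |c z| else 0)
      ≤ w J * (((((ℓ + 1 : ℕ) : ℝ)) ^ (d + 1))⁻¹ ^ J) ^ 2 *
          ∑ z ∈ S.filter (fun z => blockMap ((ℓ + 1) ^ J) z = blockMap ((ℓ + 1) ^ J) x), |c z| := by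
    refine (Finset.sum_le_sum hcollapse).trans (le_of_eq ?_)
    rw [Finset.sum_ite_eq', if_pos (Finset.mem_range.mpr (Nat.lt_succ_of_le hJn))]
  by_cases hJ2 : 2 ≤ J
  · -- DEEP SITE: everything vanishes
    have hx2 : x ∈ cube (ℓ + 1) a M ρ k 2 := mem_cube_of_le_tower hL a M hρL hnk hJn hJ2 hxJ
    have hk2 : 2 ≤ k := le_trans (le_trans hJ2 hJn) hnk
    have hxd : (ρ : ℤ) * (ℓ + 1 : ℕ) ≤ depth hd (ℓ + 1) a M ρ k 1 x := by
      have := depth_ge_of_mem_inner hd a M ρ (show 1 < 2 by norm_num) hk2 hx2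
      push_cast at this ⊢; rw [pow_one] at this; linarith
    have hnb : ∀ μ, c (x + e μ) = 0 ∧ c (x - e μ) = 0 := by
      intro μ
      obtain ⟨h1, h2⟩ := abs_depth_sub_step_le hd (ℓ + 1) a M ρ k 1 x μ
      rw [abs_le] at h1 h2
      have hxd' : (ρ : ℤ) * (ℓ + 1 : ℕ) + 1 ≤ depth hd (ℓ + 1) a M ρ k 1 x := by
        have := depth_ge_of_mem_inner hd a M ρ (show 1 < 2 by norm_num) hk2 hx2
        push_cast at this ⊢; rw [pow_one] at this; linarith
      exact ⟨hdeep _ (by linarith) hxd, hdeep _ (by linarith) hxd⟩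
    have hblk : ∑ z ∈ S.filter (fun z => blockMap ((ℓ + 1) ^ J) z = blockMap ((ℓ + 1) ^ J) x), |c z| = 0 := by
      refine Finset.sum_eq_zero fun z hz => ?_
      rw [Finset.mem_filter] at hz
      have hzJ : z ∈ cube (ℓ + 1) a M ρ k J := mem_cube_of_tower hL a M ρ (by rw [hz.2]; exact hxJ)
      have hz2 : z ∈ cube (ℓ + 1) a M ρ k 2 := by
        have hsub := cubeFam_antitone hL a M hρL k hJ2
        rw [cubeFam_false_of_le _ a M ρ (hJn.trans hnk), cubeFam_false_of_le _ a M ρ hk2] at hsub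
        exact hsub hzJ
      have hzd : (ρ : ℤ) * (ℓ + 1 : ℕ) ≤ depth hd (ℓ + 1) a M ρ k 1 z := by
        have := depth_ge_of_mem_inner hd a M ρ (show 1 < 2 by norm_num) hk2 hz2
        push_cast at this ⊢; rw [pow_one] at this; linarith
      rw [hdeep z hzd hxd, abs_zero]
    have hzero : ∑ z ∈ S, |K x z| * |c z| ≤ 0 := by
      refine hrow.trans ?_
      have h1 : ∑ μ : Fin (d + 1), (2 * |c x| + |c (x + e μ)| + |c (x - e μ)|) = 0 :=
        Finset.sum_eq_zero fun μ _ => by rw [hcx, (hnb μ).1, (hnb μ).2, abs_zero]; ring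
      rw [h1, mul_zero, zero_add]
      refine hlevel.trans ?_
      rw [hblk, mul_zero]
    have h0 : |∑ z ∈ S, K x z * c z| = 0 := le_antisymm (habs.trans hzero) (abs_nonneg _)
    rw [h0, mul_zero]
    positivity
  · -- SHALLOW SITE: tower level `J ≤ 1`, so `j ≤ 1`
    push Not at hJ2
    have hj1 : j ≤ 1 := by
      by_contra hj2; push Not at hj2
      rcases Nat.lt_or_ge J n with hJlt | hJge
      · exact not_mem_cube_of_tower_lt hL a M hρL hnk hJlt (lt_of_lt_of_le hJ2 hj2) (hj.trans hnk) hxJ hxj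
      · omega
    -- weight `≤ (Lη)²`
    have hwt : ((((ℓ + 1 : ℕ) : ℝ)) ^ j * η) ^ 2 ≤ ((((ℓ + 1 : ℕ) : ℝ)) * η) ^ 2 := by
      rw [mul_pow, mul_pow]
      refine mul_le_mul_of_nonneg_right (pow_le_pow_left₀ (by positivity) ?_ 2) (sq_nonneg η)
      calc (((ℓ + 1 : ℕ) : ℝ)) ^ j ≤ (((ℓ + 1 : ℕ) : ℝ)) ^ 1 := pow_le_pow_right₀ hLr hj1
        _ = _ := pow_one _
    -- neighbour part
    have hl1 : ∀ μ, (l1dist (x + e μ) x : ℝ) ≤ 1 ∧ (l1dist (x - e μ) x : ℝ) ≤ 1 := by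
      intro μ
      obtain ⟨h1, h2⟩ := abs_l1dist_step_le x x μ
      rw [l1dist_self, sub_zero, abs_le] at h1 h2
      exact ⟨by exact_mod_cast h1.2, by exact_mod_cast h2.2⟩
    have hnbr : ∑ μ : Fin (d + 1), (2 * |c x| + |c (x + e μ)| + |c (x - e μ)|) ≤ ((d : ℝ) + 1) * (2 * (A + B) / s) := by
      calc ∑ μ : Fin (d + 1), (2 * |c x| + |c (x + e μ)| + |c (x - e μ)|)
          ≤ ∑ _μ : Fin (d + 1), (2 * (A + B) / s) := Finset.sum_le_sum fun μ _ => by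
            rw [hcx, abs_zero, mul_zero, zero_add]
            have h1 := (hcle (x + e μ)).trans (mul_le_mul_of_nonneg_right (div_le_div_of_nonneg_right (hl1 μ).1 hs0.le) (by positivity))
            have h2 := (hcle (x - e μ)).trans (mul_le_mul_of_nonneg_right (div_le_div_of_nonneg_right (hl1 μ).2 hs0.le) (by positivity))
            rw [one_div] at h1 h2
            have : 2 * (A + B) / (s : ℝ) = (s : ℝ)⁻¹ * (A + B) + (s : ℝ)⁻¹ * (A + B) := by field_simp; ring
            linarith
        _ = ((d : ℝ) + 1) * (2 * (A + B) / s) := by rw [Finset.sum_const, Finset.card_univ, Fintype.card_fin, nsmul_eq_mul]; push_cast; ring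
    -- block part: `J = 0` gives nothing, `J = 1` gives at most `L^{d+1}` terms of size `(d+1)(L−1)(A+B)/s`
    have hblock : w J * (((((ℓ + 1 : ℕ) : ℝ)) ^ (d + 1))⁻¹ ^ J) ^ 2 *
        ∑ z ∈ S.filter (fun z => blockMap ((ℓ + 1) ^ J) z = blockMap ((ℓ + 1) ^ J) x), |c z| ≤ (η ^ 2)⁻¹ * (8 * ((d : ℝ) + 1) * (A + B) / s) := by
      rcases Nat.le_one_iff_eq_zero_or_eq_one.mp (Nat.lt_succ_iff.mp hJ2) with hJ0 | hJ1
      · -- `J = 0`: the block is `{x}` and `c x = 0`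
        subst hJ0
        have h0 : ∑ z ∈ S.filter (fun z => blockMap ((ℓ + 1) ^ 0) z = blockMap ((ℓ + 1) ^ 0) x), |c z| = 0 := by
          refine Finset.sum_eq_zero fun z hz => ?_
          rw [Finset.mem_filter, blockMap_pow_zero, blockMap_pow_zero] at hz
          rw [hz.2, hcx, abs_zero]
        rw [h0, mul_zero]; positivity
      · subst hJ1
        have hfullB : ∀ z, blockMap (ℓ + 1) z = blockMap (ℓ + 1) x → z ∈ S := by
          intro z hz
          exact (hS z).mpr (towerBlock_subset_cube hL a M hρL hnk hJn hxJ (by rw [pow_one]; exact hz))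
        have hcard := card_filter_block_le ℓ S x hfullB
        have hterm : ∀ z ∈ S.filter (fun z => blockMap ((ℓ + 1) ^ 1) z = blockMap ((ℓ + 1) ^ 1) x),
            |c z| ≤ ((d : ℝ) + 1) * ℓ / s * (A + B) := by
          intro z hz
          rw [Finset.mem_filter, pow_one] at hz
          have hb := l1dist_le_of_blockMap_eq hL hz.2
          refine (hcle z).trans (mul_le_mul_of_nonneg_right (div_le_div_of_nonneg_right ?_ hs0.le) (by positivity))
          have : ((l1dist z x : ℤ) : ℝ) ≤ (((d + 1 : ℕ) : ℤ) * ((ℓ + 1 : ℕ) - 1) : ℤ) := by exact_mod_cast hb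
          push_cast at this; linarith
        have hsum : ∑ z ∈ S.filter (fun z => blockMap ((ℓ + 1) ^ 1) z = blockMap ((ℓ + 1) ^ 1) x), |c z|
            ≤ ((ℓ + 1 : ℕ) : ℝ) ^ (d + 1) * (((d : ℝ) + 1) * ℓ / s * (A + B)) := by
          refine (Finset.sum_le_sum hterm).trans ?_
          rw [Finset.sum_const, nsmul_eq_mul]
          refine mul_le_mul_of_nonneg_right ?_ (by positivity)
          have hc' : (S.filter (fun z => blockMap ((ℓ + 1) ^ 1) z = blockMap ((ℓ + 1) ^ 1) x)).card ≤ (ℓ + 1) ^ (d + 1) := by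
            simpa only [pow_one] using hcard
          exact_mod_cast hc'
        -- the coefficient `w₁L^{−2(d+1)} = η⁻²a₁L^{−2}L^{−(d+1)}`
        have hw1 := hw 1 le_rfl hn
        rw [pow_one] at hw1
        have hLpos : (0 : ℝ) < ((ℓ + 1 : ℕ) : ℝ) := by positivity
        calc w 1 * (((((ℓ + 1 : ℕ) : ℝ)) ^ (d + 1))⁻¹ ^ 1) ^ 2 *
              ∑ z ∈ S.filter (fun z => blockMap ((ℓ + 1) ^ 1) z = blockMap ((ℓ + 1) ^ 1) x), |c z|
            ≤ ((η ^ 2)⁻¹ * levC d ℓ aw 1) * (((ℓ + 1 : ℕ) : ℝ) ^ (d + 1) * (((d : ℝ) + 1) * ℓ / s * (A + B))) := by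
              rw [pow_one, hw1]
              exact mul_le_mul_of_nonneg_left hsum (mul_nonneg (by positivity) (le_of_lt_or_eq (Or.inr rfl) |>.trans
                (by unfold levC; positivity)))
          _ = (η ^ 2)⁻¹ * (aw 1 * (((d : ℝ) + 1) * (A + B) / s) * ((ℓ : ℝ) / ((ℓ : ℝ) + 1) ^ 2)) := by
              unfold levC
              have : ((ℓ + 1 : ℕ) : ℝ) = (ℓ : ℝ) + 1 := by push_cast; ring
              rw [this]
              field_simp
          _ ≤ (η ^ 2)⁻¹ * (8 * (((d : ℝ) + 1) * (A + B) / s) * 1) := by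
              refine mul_le_mul_of_nonneg_left ?_ (by positivity)
              refine mul_le_mul (mul_le_mul_of_nonneg_right haw8 (by positivity)) ?_ (by positivity) (by positivity)
              rw [div_le_one (by positivity)]
              nlinarith [Nat.cast_nonneg (α := ℝ) ℓ]
          _ = (η ^ 2)⁻¹ * (8 * ((d : ℝ) + 1) * (A + B) / s) := by ring
    -- assemble
    have hη2 : 0 < η ^ 2 := by positivity
    have hrow' : ∑ z ∈ S, |K x z| * |c z| ≤ (η ^ 2)⁻¹ * (10 * ((d : ℝ) + 1) * (A + B) / s) := by
      refine hrow.trans ?_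
      calc (η ^ 2)⁻¹ * ∑ μ : Fin (d + 1), (2 * |c x| + |c (x + e μ)| + |c (x - e μ)|)
            + ∑ j' ∈ Finset.range (n + 1), (if blockMap ((ℓ + 1) ^ j') x ∈ cubeLamS (ℓ + 1) a M ρ k n j' then
              w j' * (((((ℓ + 1 : ℕ) : ℝ)) ^ (d + 1))⁻¹ ^ j') ^ 2 *
                ∑ z ∈ S.filter (fun z => blockMap ((ℓ + 1) ^ j') z = blockMap ((ℓ + 1) ^ j') x), |c z| else 0)
          ≤ (η ^ 2)⁻¹ * (((d : ℝ) + 1) * (2 * (A + B) / s)) + (η ^ 2)⁻¹ * (8 * ((d : ℝ) + 1) * (A + B) / s) :=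
            add_le_add (mul_le_mul_of_nonneg_left hnbr (by positivity)) (hlevel.trans hblock)
        _ = (η ^ 2)⁻¹ * (10 * ((d : ℝ) + 1) * (A + B) / s) := by ring
    calc ((((ℓ + 1 : ℕ) : ℝ)) ^ j * η) ^ 2 * |∑ z ∈ S, K x z * c z|
        ≤ ((((ℓ + 1 : ℕ) : ℝ)) * η) ^ 2 * ((η ^ 2)⁻¹ * (10 * ((d : ℝ) + 1) * (A + B) / s)) :=
          mul_le_mul hwt (habs.trans hrow') (abs_nonneg _) (by positivity)
      _ = 10 * ((d : ℝ) + 1) * (((ℓ + 1 : ℕ) : ℝ)) ^ 2 * (A + B) / s := by field_simp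

/-! ## §5 The gradient of `P u` at deep bonds is the gradient of the region-A field -/

open B6Prop22DerivMultiLevelBox (dMat_mulVec_of_mem)
open B8Eq191FlatDirichletDepth (mem_cube_iff_one_le_depth)
open B8CubeMemberBoxRows (add_shift_single)

/-- **AT DEEP BONDS `P u` IS THE REGION-A FIELD**: if both ends of the bond `⟨y, y + e_μ⟩` have depth into `□₁` at least `4s`, then `h̃_A = 1`, `h̃_B = 0`
there and `(Pu)(y + e_μ) − (Pu)(y) = η²·(∂_μ G′uA)(y + t)` — p21's forward difference `dMat` of the host box.
[cite: Balaban1985RegularSpaces, (1.101) p.93 («… and the norm |·|₍₋₁₎ for their first derivatives»); Balaban1984PropagatorsII, (2.67) p.234] -/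
theorem parametrix_grad_deep {ℓ Mh : ℕ} (hℓ : 1 ≤ ℓ) (hMh : 1 ≤ Mh) (a : Fin (d + 1) → ℤ) {M ρ k n : ℕ} (hn : 1 ≤ n) (hnk : n ≤ k)
    {η : ℝ} (aw : ℕ → ℝ) {s : ℕ} (hs : 1 ≤ s)
    (uA : ↥(boxDom (N0 ℓ Mh n (boxP ℓ M ρ k n))) → ℝ)
    (gAx : (Fin (d + 1) → ℤ) → ℝ)
    (hgAx : ∀ y : ↥(boxDom (N0 ℓ Mh n (boxP ℓ M ρ k n))),
      gAx (y.1 - shift ℓ Mh a ρ k n) = (gml (N0 ℓ Mh n (boxP ℓ M ρ k n)) ℓ n (lev ℓ Mh a M ρ k n) aw *ᵥ uA) y)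
    (gBx : (Fin (d + 1) → ℤ) → ℝ)
    {y : Fin (d + 1) → ℤ} (μ : Fin (d + 1)) (hy : 4 * (s : ℤ) ≤ depth (Nat.succ_pos d) (ℓ + 1) a M ρ k 1 y)
    (hy' : 4 * (s : ℤ) ≤ depth (Nat.succ_pos d) (ℓ + 1) a M ρ k 1 (y + e μ)) :
    ∃ (h₁ : y + shift ℓ Mh a ρ k n ∈ boxDom (N0 ℓ Mh n (boxP ℓ M ρ k n)))
      (_h₂ : y + shift ℓ Mh a ρ k n + Pi.single μ 1 ∈ boxDom (N0 ℓ Mh n (boxP ℓ M ρ k n))),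
      (cutAt (Nat.succ_pos d) (ℓ + 1) a M ρ k s (y + e μ) * (η ^ 2 * gAx (y + e μ)) + cutBt (Nat.succ_pos d) (ℓ + 1) a M ρ k s (y + e μ) * gBx (y + e μ))
        - (cutAt (Nat.succ_pos d) (ℓ + 1) a M ρ k s y * (η ^ 2 * gAx y) + cutBt (Nat.succ_pos d) (ℓ + 1) a M ρ k s y * gBx y)
      = η ^ 2 * (dMat (N0 ℓ Mh n (boxP ℓ M ρ k n)) μ *ᵥ (gml (N0 ℓ Mh n (boxP ℓ M ρ k n)) ℓ n (lev ℓ Mh a M ρ k n) aw *ᵥ uA))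
          ⟨y + shift ℓ Mh a ρ k n, h₁⟩ := by
  have hd : 0 < d + 1 := Nat.succ_pos d
  have hk : 1 ≤ k := hn.trans hnk
  have hs1 : (1 : ℤ) ≤ s := by exact_mod_cast hs
  have hs4 : (1 : ℤ) ≤ 4 * s := by linarith
  have hy1 : y ∈ cube (ℓ + 1) a M ρ k 1 := (mem_cube_iff_one_le_depth hd a M ρ hk y).mpr (by linarith)
  have hy1' : y + e μ ∈ cube (ℓ + 1) a M ρ k 1 := (mem_cube_iff_one_le_depth hd a M ρ hk _).mpr (by linarith)
  have h₁ := mem_boxDom_of_mem_cube hℓ hMh a hn hnk hy1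
  have h₂' := mem_boxDom_of_mem_cube hℓ hMh a hn hnk hy1'
  have heq : y + e μ + shift ℓ Mh a ρ k n = y + shift ℓ Mh a ρ k n + Pi.single μ 1 := ((add_shift_single (shift ℓ Mh a ρ k n) y μ).1).symm
  have h₂ : y + shift ℓ Mh a ρ k n + Pi.single μ 1 ∈ boxDom (N0 ℓ Mh n (boxP ℓ M ρ k n)) := by rw [← heq]; exact h₂'
  refine ⟨h₁, h₂, ?_⟩
  -- plateau values of the cutoffs
  have hs2 : 2 * (s : ℤ) ≤ 4 * s := by linarith
  rw [(cutAt_eq_of_depth hd (ℓ + 1) a M ρ k hs y).1 (hs2.trans hy), (cutAt_eq_of_depth hd (ℓ + 1) a M ρ k hs (y + e μ)).1 (hs2.trans hy'),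
    (cutBt_facts hd (ℓ + 1) a M ρ k hs y).2.2.1 hy, (cutBt_facts hd (ℓ + 1) a M ρ k hs (y + e μ)).2.2.1 hy']
  -- the forward difference of the host box
  rw [dMat_mulVec_of_mem μ h₂]
  have e1 : gAx y = (gml (N0 ℓ Mh n (boxP ℓ M ρ k n)) ℓ n (lev ℓ Mh a M ρ k n) aw *ᵥ uA) ⟨y + shift ℓ Mh a ρ k n, h₁⟩ := by
    rw [← hgAx ⟨_, h₁⟩]; simp only [add_sub_cancel_right]
  have e2 : gAx (y + e μ) = (gml (N0 ℓ Mh n (boxP ℓ M ρ k n)) ℓ n (lev ℓ Mh a M ρ k n) aw *ᵥ uA) ⟨y + shift ℓ Mh a ρ k n + Pi.single μ 1, h₂⟩ := by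
    rw [← hgAx ⟨_, h₂⟩]; simp only [← heq, add_sub_cancel_right]
  rw [e1, e2]; ring

end Literature.MathematicalPhysics.QuantumFieldTheory.Balaban1983to89.B8Eq1101CubeMemberParametrixIdentity
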